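import Literature.MathematicalPhysics.QuantumFieldTheory.Balaban1983to89.B11Eq88LaplaceH1CurrentLetter
import Literature.MathematicalPhysics.QuantumFieldTheory.Balaban1983to89.B11Eq73KernelColumnsCarrier

/-!
# `Balaban1983to89.B11Eq88LaplaceH1CurrentNorm` — T. Bałaban, *The variational problem and background fields in renormalization group method for lattice
# gauge theories*, Commun. Math. Phys. **102** (1985) 277–309 [Balaban1985Variational] (87)–(88) p. 291 («… we can estimate this functional derivative by
# O(1)ε₁(Lʲη)⁻³ on Ω_j»), (46) p. 285, (115) p. 294; [Balaban1985BackgroundPropagators] (3.132)–(3.133) p. 422: **THE LATTICE-FREE OPERATOR LETTER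
# `N₁ = ‖currentCLM(Δ̃_{a,k} − Q_k†aQ_k) ∘ H̃_{1,k}‖_{|·|₍₋₀₎ → |·|₍₋₃₎} ≤ w̄₃·M_φBM_φ′·d·K_d(δ)·w̲_B⁻¹`** — the composite `(π†Δ^ηπ + D R_k D*)∘H̃_{1,k}` of the
# W₂-rows (88) as a bounded map from the block fields `𝒳` to the `|·|₍₋₃₎`-currents with a constant chosen BEFORE the lattice (the row count of the
# one-block kernel letter `B11Eq88LaplaceH1CurrentLetter.exists_oneBlock_letter_laplaceH1_current` over the `d·|T_m|` coarse bonds, `B4Sect5Torus.torusSum_le`)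

WHY (NE9 leaf-01 gen 97, memo §2 (E′)).  This is the lattice-free replacement of the ill-posed displayed W-letter `M_Δ = ‖Δπ‖` for the row `Δ_π HD(A′)`:
with `HD(A′) = H̃(X)`, `‖(Δ̃ − Q†aQ)H̃X‖₍₋₃₎ ≤ N₁‖X‖`, `N₁ = w̄₃·M_φBM_φ′·dK_d(δ)·w̲_B⁻¹ ≤ ω³·M_φBM_φ′·dK_d(δ)·Ω` on the chart's profile displays.

WHAT THIS FILE PROVES (0 def, 0 sorry, axioms standard).  **`exists_norm_current_laplaceH1_le`** — `∃ (α₁, j₁, B, δ)` BEFORE (K80)'s binder block; then for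
every level profile, derivative letter and block field `X`: `‖currentCLM φ lev₁ Dc (laplaceAkPi … a − Q_k†∘(aQ_k)) (H̃_{1,k}X)‖ ≤ w̄₃·(M_φ·B·M_φ′·(d·K_d(δ)))·w̲_B⁻¹·‖X‖`
(`X = Σ_y δ_yX(y)` by `negSup_sum_single`, the one-block letter per `y`, `‖X(y)‖ ≤ w̲_B⁻¹‖X‖`, the row sum `Σ_y e^{−δd_m(Π(b₋),y₋)} ≤ d·K_d(δ)`, `‖K‖₍₋₃₎ ≤ w̄₃‖K‖_∞`).
HONEST SCOPE.  Letter algebra on the cell's MODEL (O-NE9-1; #5 UNRULED); hypotheses as in (K80); NOT the transposed letter `N₂` (pairing form, `B11Eq88LaplaceH1Identity`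
§2 — needs the column count instead), NOT the re-typed Prop. 4 (g98 (E′)(1)); NE9 NOT PRINTED ∕ NOT PROVED; spine PROVED 0∕9; NOT infinite volume, NOT mass gap,
NOT Clay.  HONEST DEPENDENCY: continuum YM on T⁴ ⇐ BetaPertH ∧ nine spine estimates (0/9 proved); BetaPertH ⇐ (D1) ∧ (D4) ∧ CAP+tail; G-an2-4 gates asym, D1
and NE2/3/4.  NEW file; nothing modified.  Net new unproved facts: 0.
-/

noncomputable section

set_option autoImplicit false

open scoped InnerProductSpace ComplexConjugate BigOperators

namespace Literature.MathematicalPhysics.QuantumFieldTheory.Balaban1983to89.B11Eq88LaplaceH1CurrentNorm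



open B4Sect5Torus (TSite tdist tdist_nonneg tdist_symm tdist_self tdist_triangle torusSum_le)
open B4Sect5Proof (latticeConst latticeConst_nonneg)
open B9SectCLatticeCarrier (Bond DirPair bpos btgt shift unshift)
open B9Eq311L2Pairing (WL2)
open B9Eq319QprimeTorus (fineP blockCoord)
open B7Prop1Explicit (U1 Wcx boxVec)
open B11Eq103H1Complex (SiteL2K BondL2K greenK covDerivL2K covDivL2K G1LatticeK KinvLatticeK H1LatticeK H1LatticeK_eq)
open B9Eq310DeltaPrime (plaqHolU)
open B9Eq310HessianOperator (adTransportW hessOp)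
open B9Eq310HessianHermitian (adTransportW_adjoint)
open B9Eq315QTorus (perCfg cornerSite)
open B9Eq315QTower (towerP UlevOf)
open B9Eq316TowerFlatIsOneStep (towerP_eq_fineP_pow siteCast)
open B9Eq326OperatorTower (QprimeTowerW QkW RofUk laplaceAk G1k)
open B9Eq324DeltaPrimeATower (laplacePrimeAk GpOfUk)
open B9Eq33CovDerivLocalLetterTower (tdist_bigBlock_bpos_btgt_le_one)
open B9Eq3117GaugeModeStencilLettersTower (local_hessOp_covDerivL2K_tower local_covDivL2K_hessOp_tower)
open B9Eq3132QGtildeQInvLetterClosed (exists_local_letter_KinvLatticeKPi)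
open B9Eq3132QadjKinvPiSupRowClosed (exists_local_letter_QadjKinvLatticeKPi)
open B11Eq88LaplaceH1CurrentLetter (exists_oneBlock_letter_laplaceH1_current)
open B11Eq73KernelColumnsCarrier (negSup_sum_single)
open B11Eq88LaplaceH1Identity (laplaceALatticeK_H1LatticeK)
open B9Eq3119DeltaPiCarrier (currentCLM equiv_currentCLM)
open B11Eq103H1Complex (H1LatticeCLM H1CLM_apply funEquiv funEquiv_symm_apply Q_H1LatticeK)
open B11Eq90V0primeCurrent (flat115 flat115_apply)
open B11Eq115Space
open B9Eq3119DeltaPiTower (piOfUk laplaceAkPi)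

variable {d : ℕ} (hd : 1 ≤ d) (L : ℕ) [NeZero L] (hL : 1 ≤ L) (hL3 : 3 ≤ L)
  {𝔸 : Type*} [NormedRing 𝔸] [NormedAlgebra ℂ 𝔸] [CompleteSpace 𝔸] [NormOneClass 𝔸] [StarRing 𝔸] [NormedStarGroup 𝔸] [StarModule ℂ 𝔸]
  {W : Type*} [NormedAddCommGroup W] [InnerProductSpace ℂ W] [FiniteDimensional ℂ W] (φ : W ≃ₗ[ℂ] 𝔸)
  {Mφ Mφ' : ℝ} (hMφ : 0 ≤ Mφ) (hMφ' : 0 ≤ Mφ') (hφ : ∀ w, ‖φ w‖ ≤ Mφ * ‖w‖) (hφ' : ∀ X, ‖φ.symm X‖ ≤ Mφ' * ‖X‖) (hstar : ∀ X : 𝔸, ‖star X‖ ≤ ‖X‖)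
  {a : ℝ} (ha : 0 < a) {a' : ℝ} (ha' : 0 < a') {ϱ : ℝ} (hϱ0 : 0 ≤ ϱ) (hϱ1 : ϱ < 1)
  (τ : 𝔸 →ₗ[ℂ] ℂ) {Cτ : ℝ} (hτ : ∀ X, ‖τ X‖ ≤ Cτ * ‖X‖) (hCτ : 0 ≤ Cτ) {Mτ : ℝ} (hτm : ∀ X Y : 𝔸, ‖τ (X * Y)‖ ≤ Mτ * ‖X‖ * ‖Y‖) (hMτ : 0 ≤ Mτ)
  {ρw : ℝ} (hρw : 0 ≤ ρw)
  (hτ₁ : ∀ X : 𝔸, τ (star X) = conj (τ X)) (hτ₂ : ∀ X Y : 𝔸, τ (X * Y) = τ (Y * X)) (hφτ : ∀ X Y : 𝔸, ⟪φ.symm X, φ.symm Y⟫_ℂ = τ (star X * Y))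
  (AQ : ℝ)

open B9Eq326G1SupRowOfLetters (letter_comp letter_mono)
open B9Eq3126H1SupRowOfLetters (letter_of_range local_letter_H1_of_letters)
open B9Eq349BlockDistanceWeight (tdist_shift_le_one)
open B9Eq315QkSingleBondLetter (norm_adjoint_QkW_apply_le_local_sharp)

set_option maxRecDepth 8192 in
set_option maxHeartbeats 800000 in -- (K80)'s ≈ 50-binder block + the carrier reading
include hd hL hL3 hMφ hMφ' hφ hφ' hstar ha ha' hϱ0 hϱ1 hτ hCτ hτm hMτ hρw hτ₁ hτ₂ hφτ in
/-- **`‖(Δ̃_{a,k} − Q_k†aQ_k)H̃_{1,k}X‖₍₋₃₎ ≤ w̄₃·M_φBM_φ′·dK_d(δ)·w̲_B⁻¹·‖X‖` WITH `(α₁, j₁, B, δ)` BEFORE THE LATTICE** — the row count of the one-block letter.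
[cite: Balaban1985Variational, (87)–(88) p.291, (46) p.285, (115) p.294; Balaban1985BackgroundPropagators, (3.132)–(3.133) p.422] -/
theorem exists_norm_current_laplaceH1_le :
    ∃ α₁ j₁ B δ : ℝ, 0 < α₁ ∧ 0 < j₁ ∧ 0 ≤ B ∧ 0 < δ ∧
      ∀ (n : ℕ) (η : ℝ) (_hηL : η * (L : ℝ) ^ (n + 1) = 1) (c₀ c₁ : ℝ) [Fact (0 < c₀)] [Fact (0 < c₁)]
        (_hw : c₀ * ((L : ℝ) ^ (n + 1)) ^ d = c₁) (_hρ : |η| ^ d / c₀ ≤ ρw) (m : Fin d → ℕ) [∀ i, NeZero (m i)] (_hm : ∀ i, 1 ≤ m i)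
        (U : Bond d (towerP L m (n + 1)) → 𝔸ˣ) (αU : ℕ → ℝ) (_hα0 : ∀ j, 0 ≤ αU j) (hα1 : ∀ j, αU j ≤ 1 / 64)
        (hαL : ∀ j, 50 * (d + 1) * αU j * (L : ℝ) ^ d ≤ 1 / 2)
        (hU1 : ∀ (j : ℕ) (x : B7Prop1Explicit.Site d) (k : Fin d), perCfg (towerP L m (j + 1)) (UlevOf L m (n + 1) U j) x k ∈ U1 𝔸)
        (hreg : ∀ (j : ℕ) (y : TSite d (towerP L m j)) (k : Fin d) (ρ' : Fin d → Fin L),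
          ‖((Wcx L (perCfg (towerP L m (j + 1)) (UlevOf L m (n + 1) U j)) (cornerSite L y) k (boxVec L ρ') : 𝔸ˣ) : 𝔸) - 1‖ ≤ αU j)
        (εU : ℕ → ℝ) (_hεU : ∀ j, 0 ≤ εU j) (_hUε : ∀ (j : ℕ) (b : Bond d (towerP L m (j + 1))), ‖(UlevOf L m (n + 1) U j b : 𝔸) - 1‖ ≤ εU j)
        (_hLb : ∀ (j : ℕ) (b : Bond d (towerP L m (j + 1))), UlevOf L m (n + 1) U j b ∈ U1 𝔸)
        (α : ℝ) (_hα : 0 ≤ α) (_hαle : α ≤ α₁)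
        (hUst : ∀ b, star (U b : 𝔸) = (((U b)⁻¹ : 𝔸ˣ) : 𝔸)) (_hUb : ∀ b, U b ∈ U1 𝔸) (_hUη : ∀ b, ‖(U b : 𝔸) - 1‖ ≤ α * η)
        (_hpl : ∀ p : B9SectCLatticeCarrier.Plaq d (towerP L m (n + 1)), ‖(plaqHolU U p : 𝔸) - 1‖ ≤ α * η ^ 2)
        (_hUgrad : ∀ (x : TSite d (towerP L m (n + 1))) (μ : Fin d), ‖(U (x, μ) : 𝔸) - U (unshift μ x, μ)‖ ≤ α * η ^ 2)
        (_hRlev : ∀ (j : ℕ) (b : Bond d (towerP L m (j + 1))) (w : W), ‖adTransportW φ (UlevOf L m (n + 1) U j) b w‖ ≤ ‖w‖)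
        (_hεg : ∀ j < n + 1, εU j ≤ α * ϱ ^ j) (_hAQ : ∑ j ∈ Finset.range (n + 1), αU j ≤ AQ)
        (hpos' : ∀ x : SiteL2K ℂ d (towerP L m (n + 1)) c₀ W, x ≠ 0 → 0 < RCLike.re ⟪x, laplacePrimeAk L m n φ η U a' (c₁ := c₁) x⟫_ℂ)
        (hpos : ∀ x : BondL2K ℂ d (towerP L m (n + 1)) c₀ W, x ≠ 0 →
          0 < RCLike.re ⟪x, laplaceAk L m n φ η U hL αU hα1 hU1 hreg τ (c₀ := c₀) (c₁ := c₁) a x⟫_ℂ)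
        (_hc₀η : c₀ = η ^ d) (j₀ : ℝ) (_hJ : ∀ μ y, ‖B9Eq39Adjoint.J (fun μ => B9Eq33CovDerivVector.shiftEquiv μ) (fun μ y => U (y, μ)) η μ y‖ ≤ j₀) (_hj : j₀ ≤ j₁)
        (hposπ : ∀ x : BondL2K ℂ d (towerP L m (n + 1)) c₀ W, x ≠ 0 →
          0 < RCLike.re ⟪x, laplaceAkPi L m n φ τ η U a' hpos' hL αU hα1 hU1 hreg (c₁ := c₁) a x⟫_ℂ)
        (hQ : Function.Surjective (QkW L m n φ U hL αU hα1 hU1 hreg (c₀ := c₀) (c₁ := c₁)))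
        [FiniteDimensional ℂ 𝔸] (lev₀ : Bond d (towerP L m (n + 1)) → ℕ) {κ' : Type*} [Fintype κ'] (lev₁ : κ' → ℕ)
        (Dc : (Bond d (towerP L m (n + 1)) → 𝔸) →ₗ[ℂ] (κ' → 𝔸)) (levB : Bond d m → ℕ) [Fact (0 < (L : ℝ))] [Fact (0 < η)]
        (X : NegSize (L : ℝ) η levB 0 𝔸),
        ‖currentCLM φ lev₁ Dc
              (laplaceAkPi L m n φ τ η U a' hpos' hL αU hα1 hU1 hreg (c₁ := c₁) a
                - LinearMap.adjoint (QkW L m n φ U hL αU hα1 hU1 hreg (c₀ := c₀) (c₁ := c₁)) ∘ₗ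
                    ((a : ℂ) • QkW L m n φ U hL αU hα1 hU1 hreg (c₀ := c₀) (c₁ := c₁)))
              (H1LatticeCLM (L := (L : ℝ)) (η := η) (lev₀ := lev₀) (levB := levB) φ hposπ hQ lev₁ Dc X)‖ ≤
          (NegSup.wSup (levWeight (L : ℝ) η lev₀ 3) : ℝ) * (Mφ * B * Mφ' * (d * latticeConst d δ)) *
            (NegSup.wInvSup (levWeight (L : ℝ) η levB 0) : ℝ) * ‖X‖ := by
  obtain ⟨α₁, j₁, B, δ, hα₁, hj₁, hB, hδ, HB⟩ :=
    exists_oneBlock_letter_laplaceH1_current hd L hL hL3 φ hMφ hMφ' hφ hφ' hstar ha ha' hϱ0 hϱ1 τ hτ hCτ hτm hMτ hρw hτ₁ hτ₂ hφτ AQ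
  refine ⟨α₁, j₁, B, δ, hα₁, hj₁, hB, hδ, ?_⟩
  intro n η hηL c₀ c₁ _ _ hw hρ m _ hm U αU hα0 hα1 hαL hU1 hreg εU hεU hUε hLb α hα hαle hUst hUb hUη hpl hUgrad hRlev hεg hAQ hpos' hpos hc₀η j₀ hJ hj
    hposπ hQ _ lev₀ κ' _ lev₁ Dc levB _ _ X
  classical
  have hK0 : 0 ≤ latticeConst d δ := latticeConst_nonneg d hδ.le
  have hΩ0 : 0 ≤ (NegSup.wInvSup (levWeight (L : ℝ) η levB 0) : ℝ) := NNReal.coe_nonneg _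
  have hX : ∀ y, ‖NegSup.equiv (levWeight (L : ℝ) η levB 0) 𝔸 X y‖ ≤ (NegSup.wInvSup (levWeight (L : ℝ) η levB 0) : ℝ) * ‖X‖ := fun y =>
    (norm_le_pi_norm _ y).trans (NegSup.sup_norm_le_wInvSup_mul X)
  -- the row sum of the one-block kernel letter over the coarse bonds
  have hrow : ∀ b : Bond d (towerP L m (n + 1)),
      ∑ y : Bond d m, Real.exp (-(δ * tdist m (blockCoord (L ^ (n + 1)) m (siteCast (towerP_eq_fineP_pow L m (n + 1)) (bpos b))) (bpos y)))
        ≤ d * latticeConst d δ := by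
    intro b
    rw [Fintype.sum_prod_type]
    simp only [bpos]
    rw [Finset.sum_comm, Finset.sum_const, Finset.card_univ, Fintype.card_fin, nsmul_eq_mul]
    exact mul_le_mul_of_nonneg_left (torusSum_le d hm hδ _) (Nat.cast_nonneg d)
  -- pointwise: the current at the fine bond `b` through the one-block pieces of `X`
  have hpt : ∀ b : Bond d (towerP L m (n + 1)),
      ‖NegSup.equiv (levWeight (L : ℝ) η lev₀ 3) 𝔸 (currentCLM φ lev₁ Dc
          (laplaceAkPi L m n φ τ η U a' hpos' hL αU hα1 hU1 hreg (c₁ := c₁) a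
            - LinearMap.adjoint (QkW L m n φ U hL αU hα1 hU1 hreg (c₀ := c₀) (c₁ := c₁)) ∘ₗ
                ((a : ℂ) • QkW L m n φ U hL αU hα1 hU1 hreg (c₀ := c₀) (c₁ := c₁)))
          (H1LatticeCLM (L := (L : ℝ)) (η := η) (lev₀ := lev₀) (levB := levB) φ hposπ hQ lev₁ Dc X)) b‖ ≤
        Mφ * B * Mφ' * (d * latticeConst d δ) * ((NegSup.wInvSup (levWeight (L : ℝ) η levB 0) : ℝ) * ‖X‖) := by
    intro b
    have hdec : NegSup.equiv (levWeight (L : ℝ) η lev₀ 3) 𝔸 (currentCLM φ lev₁ Dc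
          (laplaceAkPi L m n φ τ η U a' hpos' hL αU hα1 hU1 hreg (c₁ := c₁) a
            - LinearMap.adjoint (QkW L m n φ U hL αU hα1 hU1 hreg (c₀ := c₀) (c₁ := c₁)) ∘ₗ
                ((a : ℂ) • QkW L m n φ U hL αU hα1 hU1 hreg (c₀ := c₀) (c₁ := c₁)))
          (H1LatticeCLM (L := (L : ℝ)) (η := η) (lev₀ := lev₀) (levB := levB) φ hposπ hQ lev₁ Dc X)) b
        = ∑ y : Bond d m, NegSup.equiv (levWeight (L : ℝ) η lev₀ 3) 𝔸 (currentCLM φ lev₁ Dc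
          (laplaceAkPi L m n φ τ η U a' hpos' hL αU hα1 hU1 hreg (c₁ := c₁) a
            - LinearMap.adjoint (QkW L m n φ U hL αU hα1 hU1 hreg (c₀ := c₀) (c₁ := c₁)) ∘ₗ
                ((a : ℂ) • QkW L m n φ U hL αU hα1 hU1 hreg (c₀ := c₀) (c₁ := c₁)))
          (H1LatticeCLM (L := (L : ℝ)) (η := η) (lev₀ := lev₀) (levB := levB) φ hposπ hQ lev₁ Dc
            ((NegSup.equiv (levWeight (L : ℝ) η levB 0) 𝔸).symm (Pi.single y (NegSup.equiv (levWeight (L : ℝ) η levB 0) 𝔸 X y))))) b := by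
      conv_lhs => rw [← negSup_sum_single X]
      rw [map_sum, map_sum, ← NegSup.evalCLM_apply (𝕜 := ℂ), map_sum]
      simp only [NegSup.evalCLM_apply]
    rw [hdec]
    refine (norm_sum_le _ _).trans ?_
    calc ∑ y : Bond d m, ‖NegSup.equiv (levWeight (L : ℝ) η lev₀ 3) 𝔸 (currentCLM φ lev₁ Dc
            (laplaceAkPi L m n φ τ η U a' hpos' hL αU hα1 hU1 hreg (c₁ := c₁) a
              - LinearMap.adjoint (QkW L m n φ U hL αU hα1 hU1 hreg (c₀ := c₀) (c₁ := c₁)) ∘ₗ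
                  ((a : ℂ) • QkW L m n φ U hL αU hα1 hU1 hreg (c₀ := c₀) (c₁ := c₁)))
            (H1LatticeCLM (L := (L : ℝ)) (η := η) (lev₀ := lev₀) (levB := levB) φ hposπ hQ lev₁ Dc
              ((NegSup.equiv (levWeight (L : ℝ) η levB 0) 𝔸).symm (Pi.single y (NegSup.equiv (levWeight (L : ℝ) η levB 0) 𝔸 X y))))) b‖
        ≤ ∑ y : Bond d m, Mφ * B * Mφ' * Real.exp (-(δ * tdist m (blockCoord (L ^ (n + 1)) m
              (siteCast (towerP_eq_fineP_pow L m (n + 1)) (bpos b))) (bpos y))) * ((NegSup.wInvSup (levWeight (L : ℝ) η levB 0) : ℝ) * ‖X‖) :=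
          Finset.sum_le_sum fun y _ =>
            (HB n η hηL c₀ c₁ hw hρ m hm U αU hα0 hα1 hαL hU1 hreg εU hεU hUε hLb α hα hαle hUst hUb hUη hpl hUgrad hRlev hεg hAQ hpos' hpos hc₀η
              j₀ hJ hj hposπ hQ lev₀ lev₁ Dc levB y _ b).trans (mul_le_mul_of_nonneg_left (hX y) (by positivity))
      _ = Mφ * B * Mφ' * (∑ y : Bond d m, Real.exp (-(δ * tdist m (blockCoord (L ^ (n + 1)) m
              (siteCast (towerP_eq_fineP_pow L m (n + 1)) (bpos b))) (bpos y)))) * ((NegSup.wInvSup (levWeight (L : ℝ) η levB 0) : ℝ) * ‖X‖) := by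
          rw [Finset.mul_sum, Finset.sum_mul]
      _ ≤ Mφ * B * Mφ' * (d * latticeConst d δ) * ((NegSup.wInvSup (levWeight (L : ℝ) η levB 0) : ℝ) * ‖X‖) := by
          gcongr
          exact hrow b
  -- the weighted sup norm of the current
  have hsup : ‖NegSup.equiv (levWeight (L : ℝ) η lev₀ 3) 𝔸 (currentCLM φ lev₁ Dc
          (laplaceAkPi L m n φ τ η U a' hpos' hL αU hα1 hU1 hreg (c₁ := c₁) a
            - LinearMap.adjoint (QkW L m n φ U hL αU hα1 hU1 hreg (c₀ := c₀) (c₁ := c₁)) ∘ₗ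
                ((a : ℂ) • QkW L m n φ U hL αU hα1 hU1 hreg (c₀ := c₀) (c₁ := c₁)))
          (H1LatticeCLM (L := (L : ℝ)) (η := η) (lev₀ := lev₀) (levB := levB) φ hposπ hQ lev₁ Dc X))‖ ≤
        Mφ * B * Mφ' * (d * latticeConst d δ) * ((NegSup.wInvSup (levWeight (L : ℝ) η levB 0) : ℝ) * ‖X‖) :=
    (pi_norm_le_iff_of_nonneg (by positivity)).2 hpt
  refine (NegSup.norm_le_wSup_mul _).trans ?_
  calc (NegSup.wSup (levWeight (L : ℝ) η lev₀ 3) : ℝ) * ‖NegSup.equiv (levWeight (L : ℝ) η lev₀ 3) 𝔸 (currentCLM φ lev₁ Dc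
            (laplaceAkPi L m n φ τ η U a' hpos' hL αU hα1 hU1 hreg (c₁ := c₁) a
              - LinearMap.adjoint (QkW L m n φ U hL αU hα1 hU1 hreg (c₀ := c₀) (c₁ := c₁)) ∘ₗ
                  ((a : ℂ) • QkW L m n φ U hL αU hα1 hU1 hreg (c₀ := c₀) (c₁ := c₁)))
            (H1LatticeCLM (L := (L : ℝ)) (η := η) (lev₀ := lev₀) (levB := levB) φ hposπ hQ lev₁ Dc X))‖
        ≤ (NegSup.wSup (levWeight (L : ℝ) η lev₀ 3) : ℝ) * (Mφ * B * Mφ' * (d * latticeConst d δ) * ((NegSup.wInvSup (levWeight (L : ℝ) η levB 0) : ℝ) * ‖X‖)) :=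
          mul_le_mul_of_nonneg_left hsup (NNReal.coe_nonneg _)
    _ = _ := by ring

end Literature.MathematicalPhysics.QuantumFieldTheory.Balaban1983to89.B11Eq88LaplaceH1CurrentNorm

end
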